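import Literature.NumberTheory.LFunctions.ZetaConvexityExplicit
import Literature.NumberTheory.LFunctions.RiemannXiHadamardProduct
import Literature.NumberTheory.LFunctions.ZetaEulerLowerBound
import Literature.NumberTheory.LFunctions.BookerLemma
import Literature.NumberTheory.LFunctions.LehmanCriticalLineBound
import Literature.NumberTheory.LFunctions.TuringMethod
import HarnessLib

/-!
# Turing's method: the lower bound for `∫_{1/2}^∞ log|ζ(σ+it)| dσ` (Trudgian 2011, Lemma 2.11),
# Theorem 2.12 assembled, and Theorem 2.2 reduced to its two computational lemmas

Third layer (after `Literature/Analysis/Complex/RademacherPhragmenLindelof.lean` and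
`ZetaConvexityExplicit.lean`) of the analytic part of Turing's method with Trudgian's constants —
the bound `|∫_{t₁}^{t₂} S(t) dt| ≤ 2.067 + 0.059 log t₂` (`t₂ > t₁ > 168π`) [Trudgian 2011,
Thm 2.2], vendored as the named fact `Literature.NumberTheory.LFunctions.abs_integral_zetaArgS_le_trudgian`
(`TuringMethod.lean`) and used by Platt–Trudgian.  By Turing's lemma
(`Literature.NumberTheory.LFunctions.pi_mul_integral_zetaArgS_eq`) that bound is an upper bound
for `U(t₂)` (`ZetaConvexityExplicit.lean`, Lemmas 2.7–2.8) plus a lower bound for `U(t₁)`, where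
`U(t) = ∫_{1/2}^∞ log|ζ(σ+it)| dσ`.  This file PROVES the lower bound [Trudgian 2011, Lemma 2.11]
conditionally on exactly one named fact, Booker's integral inequality
`Literature.NumberTheory.LFunctions.Trudgian2011_lemma_2_10` (`BookerLemma.lean`; its published
proof is numerical), and assembles everything:

* `re_logDeriv_riemannXi_sub_ge` — the `Γ`-, `(s−1)`- and `π`-parts of `−ζ'/ζ` on `Im s = t`:
  `Re (ξ'/ξ − ζ'/ζ)(x+it) ≥ ½ log t − ½ log 2π − ε(t)`, `ε(t) = 3/(2t²) + π/(4t)` (`turingEps`),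
  for `x ≥ ½`, `t ≥ 1` (explicit vertical Stirling bound for `Re ψ`,
  `Literature.Analysis.SpecialFunctions.Complex.log_norm_sub_le_re_digamma`; this replaces
  Trudgian's Lemma 2.9 and bounds his `−I₂ + I₃ − (d²/2) log π` at once);
* `integral_log_norm_riemannZeta_sub_shift_ge` — `∫_{1/2}^{1/2+d}(log|ζ(s)| − log|ζ(s+d)|)
  ≥ I₁ + d²(½ log t − ½ log 2π − ε(t))`, `I₁ = ∫_{1/2}^{1/2+d}(log|ξ(s)| − log|ξ(s+d)|) dσ`;
* `integral_log_norm_riemannXi_sub_shift_ge` — **`I₁ ≥ −d² log 4 · Re ξ'/ξ(½+d+it)`**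
  (`½ < d ≤ 1`), from the Hadamard product of `ξ`
  (`Literature.NumberTheory.LFunctions.IsHadamardSeq.hasSum_log_norm_factors_sub`,
  `RiemannXiHadamardProduct.lean`), termwise integration by dominated convergence (`hasSum_phiF`),
  Booker's inequality applied to the pairs of zeros `{ρ, 1−ρ̄}` (`booker_pair_le`), the regrouping
  of the zeros `ρₙ, 1−ρₙ, ρ̄ₙ, 1−ρ̄ₙ` of a factor and of its conjugate into two such pairs
  (`neg_phiF_add_phiF_conj_le`) and the conjugation symmetry of the zero multiset
  (`IsHadamardSeq.exists_perm_eq_conj`), and `Re ξ'/ξ(s_d) = Σₙ Re[1/(s_d−ρₙ) + 1/(s_d−(1−ρₙ))]`;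
* `re_logDeriv_riemannXi_shift_le` — `Re ξ'/ξ(½+d+it) ≤ −ζ'/ζ(½+d) + ½ log t − ½ log 2π
  + ε'(t)`, `ε'(t) = 4/t² + π/(4t)` (`turingEps'`), with `|Σ Λ(n)n^{-s}| ≤ −ζ'(σ)/ζ(σ)`
  (`norm_LSeries_vonMangoldt_le_of_one_lt_re`);
* `setIntegral_Ioi_log_norm_riemannZeta_ge`, `intervalIntegral_log_norm_riemannZeta_ge` — the
  integrals beyond `½ + d` are `≥ I(d)` (`turingI`, Trudgian's `I(d)`) by `|ζ(s)| ≥ ζ(2σ)/ζ(σ)`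
  (`Literature.NumberTheory.LFunctions.norm_riemannZeta_ge_div`);
* `neg_setIntegral_Ioi_half_log_norm_riemannZeta_le` — **Lemma 2.11 (exact form)**: for
  `½ < d ≤ 1`, `t ≥ 1` not an ordinate,
  `−U(t) ≤ d² log 4 (−ζ'/ζ(½+d) + ½ log t − ½ log 2π + ε'(t)) − d²(½ log t − ½ log 2π − ε(t)) − I(d)`,
  i.e. `a₂ + b₂ log t` with `b₂ = (d²/2)(log 4 − 1)` (`trudgianB₂`) and `a₂` (`trudgianA₂`) equal to
  the printed `d² log 4{−ζ'/ζ(½+d) − ½ log 2π + ¼} + (d²/2) log π − I(d)` up to the error terms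
  (`neg_setIntegral_Ioi_half_log_norm_riemannZeta_le'`);
* `abs_integral_zetaArgS_le_trudgian_thm_2_12` — **Theorem 2.12**: for `1 < c`, `½ < d ≤ 1`,
  `1 ≤ t₀ < t₁ ≤ t₂`, `|∫_{t₁}^{t₂} S| ≤ a(c,d,t₀) + b(c,d) log t₂` with `a = (a₁+a₂)/π`
  (`trudgianA`), `2πb = ¼(c−½) + d²(log 4 − 1)` (`trudgianB`, `two_pi_mul_trudgianB`), conditional
  on `Trudgian2011_lemma_2_5_allT` (Lehman's `|ζ(½+it)| ≤ 2.53 t^{1/4}`, all `t > 1`: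
  `LehmanCriticalLineBound.lean`, giving `K = 2.53`, `θ = ¼`, `Q = 5/2`) and
  `Trudgian2011_lemma_2_10`;
* `abs_integral_zetaArgS_le_trudgian_of` — **Theorem 2.2 reduced**: the named fact
  `abs_integral_zetaArgS_le_trudgian` follows from those two facts and the two real inequalities
  `b(c,d) ≤ 0.059`, `a(c,d,168π) + (b(c,d) − 0.059) log(168π) ≤ 2.067` for some admissible `c, d`
  (Trudgian: `c = 11/10`, `d = 3/4`, `a = 2.0666`, `b = 0.0585`, §2.3) — what is left is a
  certified evaluation of `ζ(c)`, `ζ'/ζ(½+d)`, `∫ log ζ` (six real constants).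

## Faithfulness notes

1. Trudgian's `ε` (`|ε| < 9·10⁻⁵`) and `ε' ≤ 10⁻⁴` are replaced by the explicit `ε(t)`, `ε'(t)`
   above (`≈ 1.5·10⁻³` at `t = 168π`, from the tree's first-order Stirling bound
   `|Re ψ(w) − log|w|| ≤ 1/(2|w|²) + π/(4|Im w|)`); they enter `a₂` with weight `d²(1 + log 4)` and
   cost `≈ 2·10⁻³` in `πa`, immaterial after re-optimising `c` (the slack is in `b`).
2. His `I₃ ≥ 0` and the mean-value evaluation of `I₂` are not needed: the `(s−1)`- and `Γ`-parts
   are bounded pointwise through `Re 1/(w−1) ≥ −1/(2t²)`, `Re ψ(w/2) ≥ log(t/2) − …`.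
3. The paper's bound for `−I₁` (display after Lemma 2.10) has `Γ'/Γ(½ + s_d/2)`; with
   `ξ(s) = (s−1)π^{-s/2}Γ(s/2+1)ζ(s)`
   it is `½ψ(s_d/2) + 1/s_d` (`= ½ψ(s_d/2 + 1)`), which is what is bounded here; numerically the
   same to `O(t⁻²)`.
4. Nothing here uses the Riemann hypothesis or any zero-free region; `t` "not an ordinate" is
   removed at the very end by `Literature.NumberTheory.LFunctions.abs_integral_zetaArgS_le_of_bounds`.

## References

* T. S. Trudgian, *Improvements to Turing's method*, Math. Comp. 80 (2011), 2259–2279, §2.2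
  (Lemmas 2.9–2.11, Theorem 2.12), §2.3.  [Trudgian2011]
* A. R. Booker, *Artin's conjecture, Turing's method, and the Riemann hypothesis*, Experiment.
  Math. 15 (2006), Lemma 4.4.  [Booker2006]
* R. S. Lehman, *On the distribution of zeros of the Riemann zeta-function*, Proc. LMS (3) 20
  (1970), §4.  [Lehman1970]
-/

noncomputable section

open Complex Real Set MeasureTheory intervalIntegral Filter Topology
open scoped ComplexConjugate

namespace Literature.NumberTheory.LFunctions

/-! ### The non-`ξ` part of `ζ'/ζ`: `Re (ξ'/ξ − ζ'/ζ)(x+it) ≥ ½ log(t/2π) − ε(t)` -/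

/-- `Re (ξ'/ξ − ζ'/ζ)(w) = Re (1/w + 1/(w−1)) − ½ log π + ½ Re ψ(w/2)` for `Re w > 0`, `w ≠ 1`,
`ζ(w) ≠ 0` (`ξ = (s/2) Γ_ℝ ζ₁`, `Γ_ℝ'/Γ_ℝ = −½ log π + ½ ψ(s/2)`). [folklore] -/
theorem re_logDeriv_riemannXi_sub_eq {w : ℂ} (hw : 0 < w.re) (hw1 : w ≠ 1)
    (hζ : riemannZeta w ≠ 0) :
    (logDeriv riemannXi w).re - (deriv riemannZeta w / riemannZeta w).re =
      (1 / w).re + ((w - 1)⁻¹).re - Real.log π / 2 + (Complex.digamma (w / 2)).re / 2 := by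
  have hζ₁ : riemannZeta₁ w ≠ 0 := by
    rw [LFunctions.riemannZeta₁_eq_mul hw1]; exact mul_ne_zero (sub_ne_zero.2 hw1) hζ
  have h1 := logDeriv_riemannXi_eq hw hζ₁
  have h2 := LFunctions.logDeriv_riemannZeta_eq hw1 hζ
  have h3 := LFunctions.logDeriv_Gammaℝ (half_ne_neg_nat_of_re_pos' hw)
  have e : logDeriv riemannXi w - deriv riemannZeta w / riemannZeta w =
      1 / w + (w - 1)⁻¹ - (Complex.log π) / 2 + Complex.digamma (w / 2) / 2 := by
    rw [← logDeriv_apply, h2, h1, h3]; ring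
  have hre := congrArg Complex.re e
  rw [Complex.sub_re] at hre
  rw [hre]
  have hlog : ((Complex.log π) / 2).re = Real.log π / 2 := by
    rw [← Complex.ofReal_log Real.pi_pos.le]; norm_num
  have hψ : (Complex.digamma (w / 2) / 2).re = (Complex.digamma (w / 2)).re / 2 := by
    norm_num
  simp only [Complex.add_re, Complex.sub_re, hlog, hψ]

/-- The small error of the lower bound: `ε(t) = 3/(2t²) + π/(4t)`. [folklore] -/
def turingEps (t : ℝ) : ℝ := 3 / (2 * t ^ 2) + π / (4 * t)

/-- **The non-`ξ` part of `−ζ'/ζ` on a horizontal line**: for `x ≥ ½`, `t ≥ 1`, `ζ(x+it) ≠ 0`,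
`Re (ξ'/ξ − ζ'/ζ)(x + it) ≥ ½ log t − ½ log 2 − ½ log π − ε(t)`, `ε(t) = 3/(2t²) + π/(4t)`
(from `Re ψ(w/2) ≥ log|w/2| − 1/(2|w/2|²) − π/(2t)`, `|w/2| ≥ t/2`, `Re 1/w ≥ 0`,
`Re 1/(w−1) ≥ −1/(2t²)`).  Trudgian: "`½ log(t/2) + ε`, `|ε| ≤ 9·10⁻⁵`" via Lemma 2.9.
[cite: Trudgian2011, Lemma 2.9 and proof of Lemma 2.11] -/
theorem re_logDeriv_riemannXi_sub_ge {x t : ℝ} (hx : 1 / 2 ≤ x) (ht : 1 ≤ t)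
    (hζ : riemannZeta (x + t * I) ≠ 0) :
    Real.log t / 2 - Real.log 2 / 2 - Real.log π / 2 - turingEps t ≤
      (logDeriv riemannXi (x + t * I)).re -
        (deriv riemannZeta (x + t * I) / riemannZeta (x + t * I)).re := by
  set w : ℂ := x + t * I with hw
  have hwre : w.re = x := by simp [hw]
  have hwim : w.im = t := by simp [hw]
  have ht0 : 0 < t := by linarith
  have hre : 0 < w.re := by rw [hwre]; linarith
  have hw1 : w ≠ 1 := fun h ↦ by
    have := congrArg Complex.im h; rw [hwim] at this; simp at this; linarith
  rw [re_logDeriv_riemannXi_sub_eq hre hw1 hζ]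
  -- `Re 1/w ≥ 0`
  have h1 : 0 ≤ (1 / w).re := by
    rw [one_div, Complex.inv_re, hwre]; exact div_nonneg (by linarith) (Complex.normSq_nonneg _)
  -- `Re 1/(w-1) ≥ -1/(2t²)`
  have h2 : -(1 / (2 * t ^ 2)) ≤ ((w - 1)⁻¹).re := by
    rw [Complex.inv_re, Complex.normSq_apply]
    simp only [Complex.sub_re, Complex.one_re, Complex.sub_im, Complex.one_im, sub_zero, hwre, hwim]
    have hden : 0 < (x - 1) * (x - 1) + t * t := by nlinarith [sq_nonneg (x - 1)]
    rw [neg_le, ← neg_div, le_div_iff₀ (by positivity : (0:ℝ) < 2 * t ^ 2),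
      div_mul_eq_mul_div, div_le_iff₀ hden]
    nlinarith [sq_nonneg (x - 1), sq_nonneg t]
  -- the digamma term
  have hw2re : 0 < (w / 2).re := by simp [hw]; linarith
  have hw2im : (w / 2).im = t / 2 := by simp [hw]
  have hw2im' : (w / 2).im ≠ 0 := by rw [hw2im]; linarith
  have hψ := Literature.Analysis.SpecialFunctions.Complex.log_norm_sub_le_re_digamma hw2re hw2im'
  have hnorm : t / 2 ≤ ‖w / 2‖ := by
    have := abs_im_le_norm (w / 2)
    rwa [hw2im, abs_of_pos (by linarith)] at this
  have hn0 : 0 < ‖w / 2‖ := lt_of_lt_of_le (by linarith) hnorm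
  have hlog : Real.log t - Real.log 2 ≤ Real.log ‖w / 2‖ := by
    rw [← Real.log_div ht0.ne' two_ne_zero]; exact Real.log_le_log (by linarith) hnorm
  have hsq : 1 / (2 * ‖w / 2‖ ^ 2) ≤ 2 / t ^ 2 := by
    rw [div_le_div_iff₀ (by positivity) (by positivity)]
    nlinarith [hnorm, hn0]
  have habs : π / (4 * |(w / 2).im|) = π / (2 * t) := by
    rw [hw2im, abs_of_pos (by linarith)]; ring
  rw [habs] at hψ
  simp only [turingEps]
  have e3 : (3 : ℝ) / (2 * t ^ 2) = 1 / (2 * t ^ 2) + 2 / t ^ 2 / 2 := by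
    field_simp; ring
  have e4 : π / (4 * t) = π / (2 * t) / 2 := by field_simp; ring
  rw [e3, e4]
  linarith


/-! ### Per-abscissa lower bound: `log|ζ(s)/ζ(s+d)| ≥ log|ξ(s)/ξ(s+d)| + d(½ log(t/2π) − ε(t))` -/

/-- `x ↦ Re (g'/g)(x + iy)` is continuous on `[a, b]` when `g` is analytic and zero-free on
`[a, b] × {y}`. [folklore] -/
theorem continuousOn_re_logDeriv_horizontal {g : ℂ → ℂ} {y a b : ℝ}
    (hg : ∀ x ∈ Icc a b, AnalyticAt ℂ g (x + y * I)) (h0 : ∀ x ∈ Icc a b, g (x + y * I) ≠ 0) :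
    ContinuousOn (fun x : ℝ ↦ (deriv g (x + y * I) / g (x + y * I)).re) (Icc a b) := by
  intro x hx
  have hc : Continuous fun x : ℝ ↦ (x : ℂ) + y * I := by fun_prop
  have h1 : ContinuousAt (fun x : ℝ ↦ deriv g (x + y * I) / g (x + y * I)) x :=
    ((hg x hx).deriv.continuousAt.comp (f := fun x : ℝ ↦ (x : ℂ) + y * I) hc.continuousAt).div
      ((hg x hx).continuousAt.comp (f := fun x : ℝ ↦ (x : ℂ) + y * I) hc.continuousAt) (h0 x hx)
  exact (Complex.continuous_re.continuousAt.comp h1).continuousWithinAt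

/-- **The non-`ξ` part of `log|ζ(s)/ζ(s+d)|`, integrated along `[σ, σ+d]`**: for `σ ≥ ½`,
`d ≥ 0`, `t ≥ 1` not the ordinate of a zero of `ζ`,
`log|ζ(σ+it)| − log|ζ(σ+d+it)| ≥ (log|ξ(σ+it)| − log|ξ(σ+d+it)|) + d(½ log t − ½ log 2π − ε(t))`
(horizontal FTC for `log|ζ|` and `log|ξ|`, and `re_logDeriv_riemannXi_sub_ge`). This is the
`Γ`-, `(s−1)`- and `π`-part of Trudgian's decomposition `I₁ − I₂ + I₃ + I(d) − (d²/2) log π`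
(proof of Lemma 2.11) with his `I₂`, `I₃` bounded at
once: `−I₂ + I₃ − (d²/2) log π ≥ d²(½ log(t/2π) − ε(t))` after integrating over `σ`.
[cite: Trudgian2011, §2.2, proof of Lemma 2.11] -/
theorem log_norm_riemannZeta_sub_shift_ge {σ d t : ℝ} (hσ : 1 / 2 ≤ σ) (hd : 0 ≤ d) (ht : 1 ≤ t)
    (hord : ∀ ρ : ℂ, riemannZeta ρ = 0 → ρ.im ≠ t) :
    (Real.log ‖riemannXi (σ + t * I)‖ - Real.log ‖riemannXi ((σ + d : ℝ) + t * I)‖) +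
      d * (Real.log t / 2 - Real.log 2 / 2 - Real.log π / 2 - turingEps t) ≤
    Real.log ‖riemannZeta (σ + t * I)‖ - Real.log ‖riemannZeta ((σ + d : ℝ) + t * I)‖ := by
  have ht0 : 0 < t := by linarith
  have hne1 : ∀ x : ℝ, (x : ℂ) + t * I ≠ 1 := fun x h ↦ by
    have := congrArg Complex.im h; simp at this; linarith
  have hζ : ∀ x : ℝ, riemannZeta (x + t * I) ≠ 0 := fun x h ↦ hord _ h (by simp)
  have hξ : ∀ x : ℝ, riemannXi (x + t * I) ≠ 0 := fun x ↦
    riemannXi_ne_zero_of_im_eq hord (Or.inl (by simp))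
  have hζa : ∀ x ∈ Icc σ (σ + d), AnalyticAt ℂ riemannZeta (x + t * I) := fun x _ ↦
    analyticOn_riemannZeta _ (hne1 x)
  have hξa : ∀ x ∈ Icc σ (σ + d), AnalyticAt ℂ riemannXi (x + t * I) := fun x _ ↦
    differentiable_riemannXi.analyticAt _
  have hσd : σ ≤ σ + d := by linarith
  have Fζ := integral_re_logDeriv_horizontal hσd hζa (fun x _ ↦ hζ x)
  have Fξ := integral_re_logDeriv_horizontal hσd hξa (fun x _ ↦ hξ x)
  have Iζ := (continuousOn_re_logDeriv_horizontal hζa (fun x _ ↦ hζ x)).intervalIntegrable_of_Icc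
    (μ := volume) hσd
  have Iξ := (continuousOn_re_logDeriv_horizontal hξa (fun x _ ↦ hξ x)).intervalIntegrable_of_Icc
    (μ := volume) hσd
  set c : ℝ := Real.log t / 2 - Real.log 2 / 2 - Real.log π / 2 - turingEps t with hc
  have hpt : ∀ x ∈ Icc σ (σ + d), c ≤ (deriv riemannXi (x + t * I) / riemannXi (x + t * I)).re -
      (deriv riemannZeta (x + t * I) / riemannZeta (x + t * I)).re := by
    intro x hx
    have := re_logDeriv_riemannXi_sub_ge (le_trans hσ hx.1) ht (hζ x)
    rwa [logDeriv_apply] at this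
  have hmono := intervalIntegral.integral_mono_on hσd intervalIntegrable_const (Iξ.sub Iζ) hpt
  rw [intervalIntegral.integral_const, intervalIntegral.integral_sub Iξ Iζ, Fζ, Fξ, smul_eq_mul]
    at hmono
  have e : (σ + d - σ) * c = d * c := by ring
  rw [e] at hmono
  linarith

/-! ### Integrating over `σ ∈ [½, ½ + d]` -/

/-- `σ ↦ log|ζ(σ + it)|` is interval integrable on any `[a, b]` with `½ ≤ a, b` (`t > 0` not an
ordinate). [folklore] -/
theorem intervalIntegrable_log_norm_riemannZeta {t a b : ℝ} (ht : 0 < t)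
    (hord : ∀ ρ : ℂ, riemannZeta ρ = 0 → ρ.im ≠ t) (ha : 1 / 2 ≤ a) (hb : 1 / 2 ≤ b) :
    IntervalIntegrable (fun x : ℝ ↦ Real.log ‖riemannZeta (x + t * I)‖) volume a b := by
  have h := integrableOn_log_norm_riemannZeta ht hord
  have key : ∀ a b : ℝ, 1 / 2 ≤ a → a ≤ b →
      IntervalIntegrable (fun x : ℝ ↦ Real.log ‖riemannZeta (x + t * I)‖) volume a b :=
    fun a b ha hab ↦ (intervalIntegrable_iff_integrableOn_Ioc_of_le hab).2
      (h.mono_set fun x hx ↦ lt_of_le_of_lt ha hx.1)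
  rcases le_total a b with hab | hab
  · exact key a b ha hab
  · exact (key b a hb hab).symm

/-- `σ ↦ log|ξ(σ + it)|` is continuous (`t` not an ordinate, so `ξ ≠ 0` on the line). [folklore] -/
theorem continuous_log_norm_riemannXi {t : ℝ} (hord : ∀ ρ : ℂ, riemannZeta ρ = 0 → ρ.im ≠ t) :
    Continuous fun x : ℝ ↦ Real.log ‖riemannXi (x + t * I)‖ := by
  have hξ : ∀ x : ℝ, riemannXi (x + t * I) ≠ 0 := fun x ↦
    riemannXi_ne_zero_of_im_eq hord (Or.inl (by simp))
  have hc : Continuous fun x : ℝ ↦ riemannXi (x + t * I) :=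
    differentiable_riemannXi.continuous.comp (by fun_prop)
  exact continuous_iff_continuousAt.2 fun x ↦
    (hc.continuousAt.norm).log (norm_ne_zero_iff.2 (hξ x))

/-- **The first integral of Trudgian's decomposition of `∫ log|ζ|`** (proof of Lemma 2.11): for
`d ≥ 0`, `t ≥ 1` not an ordinate,
`∫_{1/2}^{1/2+d} (log|ζ(σ+it)| − log|ζ(σ+d+it)|) dσ
   ≥ ∫_{1/2}^{1/2+d} (log|ξ(σ+it)| − log|ξ(σ+d+it)|) dσ + d²(½ log t − ½ log 2π − ε(t))`.
[cite: Trudgian2011, §2.2, proof of Lemma 2.11] -/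
theorem integral_log_norm_riemannZeta_sub_shift_ge {d t : ℝ} (hd : 0 ≤ d) (ht : 1 ≤ t)
    (hord : ∀ ρ : ℂ, riemannZeta ρ = 0 → ρ.im ≠ t) :
    (∫ σ in (1 / 2 : ℝ)..(1 / 2 + d),
        (Real.log ‖riemannXi (σ + t * I)‖ - Real.log ‖riemannXi ((σ + d : ℝ) + t * I)‖)) +
      d ^ 2 * (Real.log t / 2 - Real.log 2 / 2 - Real.log π / 2 - turingEps t) ≤
    ∫ σ in (1 / 2 : ℝ)..(1 / 2 + d),
        (Real.log ‖riemannZeta (σ + t * I)‖ - Real.log ‖riemannZeta ((σ + d : ℝ) + t * I)‖) := by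
  have ht0 : 0 < t := by linarith
  set c : ℝ := Real.log t / 2 - Real.log 2 / 2 - Real.log π / 2 - turingEps t with hc
  have hle : (1 / 2 : ℝ) ≤ 1 / 2 + d := by linarith
  -- integrability
  have I1 : IntervalIntegrable (fun σ : ℝ ↦ Real.log ‖riemannZeta (σ + t * I)‖) volume
      (1 / 2) (1 / 2 + d) := intervalIntegrable_log_norm_riemannZeta ht0 hord le_rfl hle
  have I2 : IntervalIntegrable (fun σ : ℝ ↦ Real.log ‖riemannZeta ((σ + d : ℝ) + t * I)‖) volume
      (1 / 2) (1 / 2 + d) := by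
    have h := (intervalIntegrable_log_norm_riemannZeta ht0 hord hle (b := 1 / 2 + d + d)
      (by linarith)).comp_add_right d
    simp only [add_sub_cancel_right] at h
    exact h
  have hξc := continuous_log_norm_riemannXi hord
  have I3 : IntervalIntegrable (fun σ : ℝ ↦ Real.log ‖riemannXi (σ + t * I)‖ -
      Real.log ‖riemannXi ((σ + d : ℝ) + t * I)‖) volume (1 / 2) (1 / 2 + d) :=
    (hξc.intervalIntegrable _ _).sub ((hξc.comp (continuous_id.add continuous_const :
      Continuous fun σ : ℝ ↦ σ + d)).intervalIntegrable _ _)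
  have hpt : ∀ σ ∈ Icc (1 / 2 : ℝ) (1 / 2 + d),
      (Real.log ‖riemannXi (σ + t * I)‖ - Real.log ‖riemannXi ((σ + d : ℝ) + t * I)‖) + d * c ≤
      Real.log ‖riemannZeta (σ + t * I)‖ - Real.log ‖riemannZeta ((σ + d : ℝ) + t * I)‖ :=
    fun σ hσ ↦ log_norm_riemannZeta_sub_shift_ge hσ.1 hd ht hord
  have hmono := intervalIntegral.integral_mono_on hle (I3.add intervalIntegrable_const) (I1.sub I2) hpt
  rw [intervalIntegral.integral_add I3 intervalIntegrable_const, intervalIntegral.integral_const,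
    smul_eq_mul] at hmono
  have e : (1 / 2 + d - 1 / 2) * (d * c) = d ^ 2 * c := by ring
  rw [e] at hmono
  exact hmono


/-! ### The `ξ` part `I₁`: Hadamard factors, Booker's lemma, conjugate pairing -/

section HadamardBooker

/-- The `σ`-integrand of the contribution of one Hadamard factor `1 − β(2s−1)²` to
`∫ (log|ξ(s)| − log|ξ(s+d)|) dσ` along `Im s = t`. [folklore] -/
def phiIntegrand (d t : ℝ) (β : ℂ) (σ : ℝ) : ℝ :=
  Real.log ‖1 - β * (2 * ((σ : ℂ) + t * I) - 1) ^ 2‖ -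
    Real.log ‖1 - β * (2 * (((σ + d : ℝ) : ℂ) + t * I) - 1) ^ 2‖

/-- `Φ(β) = ∫_{1/2}^{1/2+d} (log|1 − β(2s−1)²| − log|1 − β(2(s+d)−1)²|) dσ`, `s = σ + it`: the
contribution of one Hadamard factor to Trudgian's `I₁`. [folklore] -/
def phiF (d t : ℝ) (β : ℂ) : ℝ := ∫ σ in (1 / 2 : ℝ)..(1 / 2 + d), phiIntegrand d t β σ

/-- `H(β) = Re (−4β(2s_d−1)/(1 − β(2s_d−1)²))`, `s_d = ½ + d + it`: the contribution of one
Hadamard factor to `Re ξ'/ξ(s_d)`. [folklore] -/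
def hF (d t : ℝ) (β : ℂ) : ℝ :=
  (-(4 * β * (2 * ((1 / 2 + d : ℝ) + t * I) - 1)) / (1 - β * (2 * ((1 / 2 + d : ℝ) + t * I) - 1) ^ 2)).re

/-- The one-zero integrand `g_ρ(σ) = log|σ + it − ρ| − log|σ + d + it − ρ|`. [folklore] -/
def gZero (d t : ℝ) (ρ : ℂ) (σ : ℝ) : ℝ :=
  Real.log ‖(σ : ℂ) + t * I - ρ‖ - Real.log ‖((σ + d : ℝ) : ℂ) + t * I - ρ‖

/-- `h_ρ = Re 1/(s_d − ρ)`, `s_d = ½ + d + it`. [folklore] -/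
def hZero (d t : ℝ) (ρ : ℂ) : ℝ := (1 / (((1 / 2 + d : ℝ) : ℂ) + t * I - ρ)).re

/-- Factorisation of a Hadamard factor at any root: if `β ≠ 0` and `(ρ − ½)² = 1/(4β)` then
`1 − β(2s−1)² = −4β (s−ρ)(s−(1−ρ))`. [folklore] -/
theorem one_sub_mul_sq_eq_of_root {β ρ : ℂ} (hβ : β ≠ 0) (hρ : (ρ - 1 / 2) ^ 2 = 1 / (4 * β))
    (s : ℂ) : 1 - β * (2 * s - 1) ^ 2 = -4 * β * ((s - ρ) * (s - (1 - ρ))) := by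
  have e : (s - ρ) * (s - (1 - ρ)) = (s - 1 / 2) ^ 2 - (ρ - 1 / 2) ^ 2 := by ring
  rw [e, hρ]
  field_simp
  ring

/-- The conjugate root belongs to the conjugate parameter. [folklore] -/
theorem conj_root {β ρ : ℂ} (hρ : (ρ - 1 / 2) ^ 2 = 1 / (4 * β)) :
    (conj ρ - 1 / 2) ^ 2 = 1 / (4 * conj β) := by
  have h := congrArg conj hρ
  simp only [map_pow, map_sub, map_div₀, map_one, map_mul, map_ofNat] at h
  exact h

/-- The partial fraction of one Hadamard term at any root:
`−4β(2s−1)/(1 − β(2s−1)²) = 1/(s−ρ) + 1/(s−(1−ρ))` (`β ≠ 0`, `s ∉ {ρ, 1−ρ}`). [folklore] -/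
theorem hadamardTerm_eq_of_root {β ρ s : ℂ} (hβ : β ≠ 0) (hρ : (ρ - 1 / 2) ^ 2 = 1 / (4 * β))
    (h1 : s ≠ ρ) (h2 : s ≠ 1 - ρ) :
    -(4 * β * (2 * s - 1)) / (1 - β * (2 * s - 1) ^ 2) = 1 / (s - ρ) + 1 / (s - (1 - ρ)) := by
  have h1' : s - ρ ≠ 0 := sub_ne_zero.2 h1
  have h2' : s - (1 - ρ) ≠ 0 := sub_ne_zero.2 h2
  rw [one_sub_mul_sq_eq_of_root hβ hρ]
  field_simp
  ring

/-- Logarithm of a Hadamard factor at a point off its zeros: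
`log|1 − β(2s−1)²| = log(4|β|) + log|s−ρ| + log|s−(1−ρ)|`. [folklore] -/
theorem log_norm_factor_eq_of_root {β ρ s : ℂ} (hβ : β ≠ 0) (hρ : (ρ - 1 / 2) ^ 2 = 1 / (4 * β))
    (h1 : s ≠ ρ) (h2 : s ≠ 1 - ρ) :
    Real.log ‖1 - β * (2 * s - 1) ^ 2‖ =
      Real.log (4 * ‖β‖) + Real.log ‖s - ρ‖ + Real.log ‖s - (1 - ρ)‖ := by
  have h1' : ‖s - ρ‖ ≠ 0 := norm_ne_zero_iff.2 (sub_ne_zero.2 h1)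
  have h2' : ‖s - (1 - ρ)‖ ≠ 0 := norm_ne_zero_iff.2 (sub_ne_zero.2 h2)
  have hβ' : (4 : ℝ) * ‖β‖ ≠ 0 := mul_ne_zero (by norm_num) (norm_ne_zero_iff.2 hβ)
  rw [one_sub_mul_sq_eq_of_root hβ hρ]
  have e : ‖-4 * β * ((s - ρ) * (s - (1 - ρ)))‖ = 4 * ‖β‖ * (‖s - ρ‖ * ‖s - (1 - ρ)‖) := by
    simp only [norm_mul, norm_neg, Complex.norm_ofNat]
  rw [e, Real.log_mul hβ' (mul_ne_zero h1' h2'), Real.log_mul h1' h2']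
  ring


/-- One Hadamard factor splits into its two zeros: for `β ≠ 0`, `(ρ−½)² = 1/(4β)` and `t` not the
ordinate of `ρ` or `1 − ρ`, `φ_β(σ) = g_ρ(σ) + g_{1−ρ}(σ)`. [folklore] -/
theorem phiIntegrand_eq_of_root {d t : ℝ} {β ρ : ℂ} (hβ : β ≠ 0)
    (hρ : (ρ - 1 / 2) ^ 2 = 1 / (4 * β)) (him : ρ.im ≠ t) (him' : (1 - ρ).im ≠ t) (σ : ℝ) :
    phiIntegrand d t β σ = gZero d t ρ σ + gZero d t (1 - ρ) σ := by
  have ne_of_im_ne : ∀ {s ρ : ℂ}, s.im ≠ ρ.im → s ≠ ρ := fun h e ↦ h (by rw [e])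
  have hs : ∀ x : ℝ, ((x : ℂ) + t * I) ≠ ρ ∧ ((x : ℂ) + t * I) ≠ 1 - ρ := fun x ↦
    ⟨ne_of_im_ne (by simpa using Ne.symm him), ne_of_im_ne (by simpa using Ne.symm him')⟩
  simp only [phiIntegrand, gZero]
  rw [log_norm_factor_eq_of_root hβ hρ (hs σ).1 (hs σ).2,
    log_norm_factor_eq_of_root hβ hρ (hs (σ + d)).1 (hs (σ + d)).2]
  ring

/-- `H(β) = h_ρ + h_{1−ρ}` for `β ≠ 0`, `(ρ−½)² = 1/(4β)`, `0 ≤ Re ρ ≤ 1`, `d > ½`. [folklore] -/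
theorem hF_eq_of_root {d t : ℝ} {β ρ : ℂ} (hβ : β ≠ 0) (hρ : (ρ - 1 / 2) ^ 2 = 1 / (4 * β))
    (h0 : 0 ≤ ρ.re) (h1 : ρ.re ≤ 1) (hd : 1 / 2 < d) :
    hF d t β = hZero d t ρ + hZero d t (1 - ρ) := by
  have ne_of_re_ne : ∀ {s ρ : ℂ}, s.re ≠ ρ.re → s ≠ ρ := fun h e ↦ h (by rw [e])
  have hne1 : ((1 / 2 + d : ℝ) : ℂ) + t * I ≠ ρ := ne_of_re_ne (by simp; linarith)
  have hne2 : ((1 / 2 + d : ℝ) : ℂ) + t * I ≠ 1 - ρ := ne_of_re_ne (by simp; linarith)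
  simp only [hF, hZero]
  rw [hadamardTerm_eq_of_root hβ hρ hne1 hne2, Complex.add_re]

/-- **Booker's lemma, translated to the pair of zeros `ρ₀`, `1 − ρ̄₀`** (reflections of each other
in the critical line): for `½ < d ≤ 1`, `0 ≤ Re ρ₀ ≤ 1` and `t ≠ Im ρ₀`,
`−∫_{1/2}^{1/2+d} (g_{ρ₀} + g_{1−ρ̄₀}) dσ ≤ d² log 4 · (h_{ρ₀} + h_{1−ρ̄₀})`
(Trudgian's Lemma 2.10 with `w = ½ + it − ρ₀`, `x = σ − ½`). [cite: Trudgian2011, Lemma 2.10] -/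
theorem booker_pair_le (hB : Trudgian2011_lemma_2_10) {d t : ℝ} (hd : 1 / 2 < d) (hd1 : d ≤ 1)
    {ρ₀ : ℂ} (h0 : 0 ≤ ρ₀.re) (h1 : ρ₀.re ≤ 1) (him : ρ₀.im ≠ t) :
    -(∫ σ in (1 / 2 : ℝ)..(1 / 2 + d), (gZero d t ρ₀ σ + gZero d t (1 - conj ρ₀) σ)) ≤
      d ^ 2 * Real.log 4 * (hZero d t ρ₀ + hZero d t (1 - conj ρ₀)) := by
  set w : ℂ := 1 / 2 + t * I - ρ₀ with hw
  have hwre : |w.re| ≤ 1 / 2 := by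
    rw [abs_le]; simp [hw]; constructor <;> linarith
  have key := hB d w hd hd1 hwre
  -- the right-hand side
  have e1 : (d : ℂ) + w = ((1 / 2 + d : ℝ) : ℂ) + t * I - ρ₀ := by
    simp only [hw]; push_cast; ring
  have e2 : (d : ℂ) - conj w = ((1 / 2 + d : ℝ) : ℂ) + t * I - (1 - conj ρ₀) := by
    simp only [hw, map_sub, map_add, map_mul, Complex.conj_ofReal, Complex.conj_I, map_div₀,
      map_one, map_ofNat]
    push_cast; ring
  rw [e1, e2] at key
  -- the left-hand side: `x = σ − ½`
  have ne_of_im_ne : ∀ {s ρ : ℂ}, s.im ≠ ρ.im → s ≠ ρ := fun h e ↦ h (by rw [e])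
  have hA : ∀ σ : ℝ, ((σ : ℂ) + t * I - ρ₀) ≠ 0 ∧ ((σ : ℂ) + t * I - (1 - conj ρ₀)) ≠ 0 := by
    intro σ
    refine ⟨sub_ne_zero.2 (ne_of_im_ne ?_), sub_ne_zero.2 (ne_of_im_ne ?_)⟩
    · simpa using Ne.symm him
    · simpa using Ne.symm him
  have hpt : ∀ σ : ℝ, bookerIntegrand d w ((σ - 1 / 2 : ℝ)) =
      -(gZero d t ρ₀ σ + gZero d t (1 - conj ρ₀) σ) := by
    intro σ
    have k1 : (((σ - 1 / 2 : ℝ)) : ℂ) + w = (σ : ℂ) + t * I - ρ₀ := by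
      simp only [hw]; push_cast; ring
    have k2 : (((σ - 1 / 2 : ℝ)) : ℂ) - conj w = (σ : ℂ) + t * I - (1 - conj ρ₀) := by
      simp only [hw, map_sub, map_add, map_mul, Complex.conj_ofReal, Complex.conj_I, map_div₀,
        map_one, map_ofNat]
      push_cast; ring
    have k3 : (((σ - 1 / 2 : ℝ)) : ℂ) + d + w = ((σ + d : ℝ) : ℂ) + t * I - ρ₀ := by
      simp only [hw]; push_cast; ring
    have k4 : (((σ - 1 / 2 : ℝ)) : ℂ) + d - conj w = ((σ + d : ℝ) : ℂ) + t * I - (1 - conj ρ₀) := by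
      simp only [hw, map_sub, map_add, map_mul, Complex.conj_ofReal, Complex.conj_I, map_div₀,
        map_one, map_ofNat]
      push_cast; ring
    rw [bookerIntegrand_def, k1, k2, k3, k4]
    simp only [gZero]
    have n1 := (hA σ).1
    have n2 := (hA σ).2
    have n3 := (hA (σ + d)).1
    have n4 := (hA (σ + d)).2
    rw [norm_div, norm_mul, norm_mul,
      Real.log_div (mul_ne_zero (norm_ne_zero_iff.2 n3) (norm_ne_zero_iff.2 n4))
        (mul_ne_zero (norm_ne_zero_iff.2 n1) (norm_ne_zero_iff.2 n2)),
      Real.log_mul (norm_ne_zero_iff.2 n3) (norm_ne_zero_iff.2 n4),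
      Real.log_mul (norm_ne_zero_iff.2 n1) (norm_ne_zero_iff.2 n2)]
    ring
  have hcongr : ∫ σ in (1 / 2 : ℝ)..(1 / 2 + d), (gZero d t ρ₀ σ + gZero d t (1 - conj ρ₀) σ) =
      ∫ σ in (1 / 2 : ℝ)..(1 / 2 + d), -bookerIntegrand d w (σ - 1 / 2) :=
    intervalIntegral.integral_congr fun σ _ ↦ by rw [hpt σ, neg_neg]
  rw [hcongr, intervalIntegral.integral_neg, neg_neg,
    intervalIntegral.integral_comp_sub_right (fun x ↦ bookerIntegrand d w x)]
  have e3 : (1 / 2 : ℝ) - 1 / 2 = 0 := by norm_num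
  have e4 : (1 / 2 : ℝ) + d - 1 / 2 = d := by ring
  rw [e3, e4]
  exact key


/-- `g_ρ` is continuous in `σ` when `t ≠ Im ρ`. [folklore] -/
theorem continuous_gZero {d t : ℝ} {ρ : ℂ} (him : ρ.im ≠ t) : Continuous (gZero d t ρ) := by
  have ne_of_im_ne : ∀ {s ρ : ℂ}, s.im ≠ ρ.im → s ≠ ρ := fun h e ↦ h (by rw [e])
  have hA : ∀ σ : ℝ, ((σ : ℂ) + t * I - ρ) ≠ 0 := fun σ ↦
    sub_ne_zero.2 (ne_of_im_ne (by simpa using Ne.symm him))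
  have h1 : Continuous fun σ : ℝ ↦ Real.log ‖(σ : ℂ) + t * I - ρ‖ :=
    continuous_iff_continuousAt.2 fun σ ↦
      ((by fun_prop : Continuous fun σ : ℝ ↦ (σ : ℂ) + t * I - ρ).continuousAt.norm).log
        (norm_ne_zero_iff.2 (hA σ))
  have h2 : Continuous fun σ : ℝ ↦ Real.log ‖((σ + d : ℝ) : ℂ) + t * I - ρ‖ :=
    h1.comp (continuous_id.add continuous_const : Continuous fun σ : ℝ ↦ σ + d)
  exact h1.sub h2

/-- **Booker's inequality for one Hadamard factor and its conjugate**: for a Hadamard sequence `b`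
of `H₀`, `½ < d ≤ 1`, and `t` not an ordinate of a zero of `ζ`,
`−(Φ(bₙ) + Φ(b̄ₙ)) ≤ d² log 4 · (H(bₙ) + H(b̄ₙ))`: the zeros `ρₙ, 1−ρₙ` of the `n`-th factor and
`ρ̄ₙ, 1−ρ̄ₙ` of its conjugate regroup into the two Booker pairs `{ρₙ, 1−ρ̄ₙ}`, `{1−ρₙ, ρ̄ₙ}`.
[cite: Trudgian2011, §2.2, after Lemma 2.10] -/
theorem neg_phiF_add_phiF_conj_le (hB : Trudgian2011_lemma_2_10) {b : ℕ → ℂ}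
    (hb : IsHadamardSeq 0 b) {d t : ℝ} (hd : 1 / 2 < d) (hd1 : d ≤ 1)
    (hord : ∀ ρ : ℂ, riemannZeta ρ = 0 → ρ.im ≠ t) (n : ℕ) :
    -(phiF d t (b n) + phiF d t (conj (b n))) ≤
      d ^ 2 * Real.log 4 * (hF d t (b n) + hF d t (conj (b n))) := by
  by_cases hn : b n = 0
  · simp [hn, phiF, phiIntegrand, hF]
  set β := b n with hβ
  set ρ := IsHadamardSeq.xiZero b n with hρdef
  have hρ : (ρ - 1 / 2) ^ 2 = 1 / (4 * β) := IsHadamardSeq.xiZero_sub_half_sq b n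
  obtain ⟨hζρ, hre0, hre1⟩ := hb.riemannZeta_xiZero hn
  have hζ1 : riemannZeta (1 - ρ) = 0 :=
    ((riemannXi_eq_zero_iff_holds _).1 (hb.riemannXi_one_sub_xiZero hn)).1
  have hζc : riemannZeta (conj ρ) = 0 := by rw [riemannZeta_conj, hζρ, map_zero]
  have hζc1 : riemannZeta (1 - conj ρ) = 0 := by
    rw [show (1 : ℂ) - conj ρ = conj (1 - ρ) by simp, riemannZeta_conj, hζ1, map_zero]
  have himρ : ρ.im ≠ t := hord ρ hζρ
  have him1 : (1 - ρ).im ≠ t := hord _ hζ1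
  have himc : (conj ρ).im ≠ t := hord _ hζc
  have himc1 : (1 - conj ρ).im ≠ t := hord _ hζc1
  have hρc := conj_root hρ
  have hβc : conj β ≠ 0 := (map_ne_zero _).2 hn
  have e1 : phiF d t β = ∫ σ in (1 / 2 : ℝ)..(1 / 2 + d), (gZero d t ρ σ + gZero d t (1 - ρ) σ) :=
    intervalIntegral.integral_congr fun σ _ ↦ phiIntegrand_eq_of_root hn hρ himρ him1 σ
  have e2 : phiF d t (conj β) =
      ∫ σ in (1 / 2 : ℝ)..(1 / 2 + d), (gZero d t (conj ρ) σ + gZero d t (1 - conj ρ) σ) :=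
    intervalIntegral.integral_congr fun σ _ ↦ phiIntegrand_eq_of_root hβc hρc himc himc1 σ
  have e3 : hF d t β = hZero d t ρ + hZero d t (1 - ρ) := hF_eq_of_root hn hρ hre0.le hre1.le hd
  have e4 : hF d t (conj β) = hZero d t (conj ρ) + hZero d t (1 - conj ρ) :=
    hF_eq_of_root hβc hρc (by simp; exact hre0.le) (by simp; exact hre1.le) hd
  have B1 := booker_pair_le hB hd hd1 hre0.le hre1.le himρ
  have B2 := booker_pair_le hB hd hd1 (ρ₀ := 1 - ρ) (by simp; linarith) (by simp; linarith) him1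
  have ec : (1 : ℂ) - conj (1 - ρ) = conj ρ := by simp
  rw [ec] at B2
  have hgi : ∀ ρ₀ : ℂ, ρ₀.im ≠ t → IntervalIntegrable (gZero d t ρ₀) volume (1 / 2) (1 / 2 + d) :=
    fun ρ₀ h ↦ (continuous_gZero h).intervalIntegrable _ _
  rw [intervalIntegral.integral_add (hgi ρ himρ) (hgi _ himc1)] at B1
  rw [intervalIntegral.integral_add (hgi _ him1) (hgi _ himc)] at B2
  rw [e1, e2, e3, e4, intervalIntegral.integral_add (hgi ρ himρ) (hgi _ him1),
    intervalIntegral.integral_add (hgi _ himc) (hgi _ himc1)]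
  linarith


/-- `σ ↦ φ_β(σ)` is continuous when `β = bₙ` comes from a Hadamard sequence of `H₀` and `t` is not
an ordinate (no factor vanishes on the line `Im s = t`). [folklore] -/
theorem continuous_phiIntegrand {b : ℕ → ℂ} (hb : IsHadamardSeq 0 b) {d t : ℝ}
    (hord : ∀ ρ : ℂ, riemannZeta ρ = 0 → ρ.im ≠ t) (n : ℕ) :
    Continuous (phiIntegrand d t (b n)) := by
  have hξ : ∀ x : ℝ, riemannXi (x + t * I) ≠ 0 := fun x ↦
    riemannXi_ne_zero_of_im_eq hord (Or.inl (by simp))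
  have hf : ∀ x : ℝ, 1 - b n * (2 * ((x : ℂ) + t * I) - 1) ^ 2 ≠ 0 := fun x ↦
    hb.factor_ne_zero' (hξ x) n
  have h1 : Continuous fun σ : ℝ ↦ Real.log ‖1 - b n * (2 * ((σ : ℂ) + t * I) - 1) ^ 2‖ :=
    continuous_iff_continuousAt.2 fun σ ↦
      ((by fun_prop : Continuous fun σ : ℝ ↦
        1 - b n * (2 * ((σ : ℂ) + t * I) - 1) ^ 2).continuousAt.norm).log
        (norm_ne_zero_iff.2 (hf σ))
  have h2 : Continuous fun σ : ℝ ↦ Real.log ‖1 - b n * (2 * (((σ + d : ℝ) : ℂ) + t * I) - 1) ^ 2‖ :=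
    h1.comp (continuous_id.add continuous_const : Continuous fun σ : ℝ ↦ σ + d)
  exact h1.sub h2

/-- Uniform smallness of the far Hadamard factors on the segment: if `‖β‖ (16 + 4t²) ≤ ½` then
`|φ_β(σ)| ≤ 3 (16 + 4t²) ‖β‖` for `σ ∈ [½, 3/2]`, `0 ≤ d ≤ 1` (`|log|1−z|| ≤ (3/2)|z|` for
`|z| ≤ ½`, and `|2s−1|² ≤ 16 + 4t²` for `½ ≤ Re s ≤ 5/2`, `Im s = t`). [folklore] -/
theorem abs_phiIntegrand_le {β : ℂ} {d t σ : ℝ} (hd : 0 ≤ d) (hd1 : d ≤ 1)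
    (hσ : σ ∈ Icc (1 / 2 : ℝ) (3 / 2)) (hβ : ‖β‖ * (16 + 4 * t ^ 2) ≤ 1 / 2) :
    |phiIntegrand d t β σ| ≤ 3 * (16 + 4 * t ^ 2) * ‖β‖ := by
  set R : ℝ := 16 + 4 * t ^ 2 with hR
  have hsq : ∀ x : ℝ, 1 / 2 ≤ x → x ≤ 5 / 2 → ‖(2 * ((x : ℂ) + t * I) - 1) ^ 2‖ ≤ R := by
    intro x hx1 hx2
    rw [norm_pow]
    have e : (2 * ((x : ℂ) + t * I) - 1) = ((2 * x - 1 : ℝ) : ℂ) + (2 * t : ℝ) * I := by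
      push_cast; ring
    rw [e, Complex.norm_add_mul_I, Real.sq_sqrt (by positivity)]
    nlinarith
  have hz : ∀ x : ℝ, 1 / 2 ≤ x → x ≤ 5 / 2 →
      |Real.log ‖1 - β * (2 * ((x : ℂ) + t * I) - 1) ^ 2‖| ≤ 3 / 2 * (‖β‖ * R) := by
    intro x hx1 hx2
    set z : ℂ := β * (2 * ((x : ℂ) + t * I) - 1) ^ 2 with hzdef
    have hz1 : ‖z‖ ≤ ‖β‖ * R := by
      rw [hzdef, norm_mul]; exact mul_le_mul_of_nonneg_left (hsq x hx1 hx2) (norm_nonneg _)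
    have hw : ‖(1 - z) - 1‖ ≤ 1 / 2 := by
      rw [sub_sub_cancel_left, norm_neg]; linarith
    have := abs_log_norm_le_of_norm_sub_one_le hw
    rw [sub_sub_cancel_left, norm_neg] at this
    linarith
  have hA := hz σ hσ.1 (by linarith [hσ.2])
  have hB := hz (σ + d) (by linarith [hσ.1]) (by linarith [hσ.2])
  simp only [phiIntegrand]
  have := abs_sub (Real.log ‖1 - β * (2 * ((σ : ℂ) + t * I) - 1) ^ 2‖)
    (Real.log ‖1 - β * (2 * (((σ + d : ℝ) : ℂ) + t * I) - 1) ^ 2‖)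
  linarith

/-- **Termwise integration of the Hadamard series for `log|ξ(s)| − log|ξ(s+d)|`**: for a Hadamard
sequence `b` of `H₀`, `0 ≤ d ≤ 1` and `t` not an ordinate,
`∑ₙ Φ(bₙ) = ∫_{1/2}^{1/2+d} (log|ξ(σ+it)| − log|ξ(σ+d+it)|) dσ` (dominated convergence: all but
finitely many terms are `≤ 3(16+4t²)‖bₙ‖` uniformly, the others are continuous). [folklore] -/
theorem hasSum_phiF {b : ℕ → ℂ} (hb : IsHadamardSeq 0 b) {d t : ℝ} (hd : 0 ≤ d) (hd1 : d ≤ 1)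
    (hord : ∀ ρ : ℂ, riemannZeta ρ = 0 → ρ.im ≠ t) :
    HasSum (fun n ↦ phiF d t (b n)) (∫ σ in (1 / 2 : ℝ)..(1 / 2 + d),
      (Real.log ‖riemannXi (σ + t * I)‖ - Real.log ‖riemannXi ((σ + d : ℝ) + t * I)‖)) := by
  have hξ : ∀ x : ℝ, riemannXi (x + t * I) ≠ 0 := fun x ↦
    riemannXi_ne_zero_of_im_eq hord (Or.inl (by simp))
  have hcont := continuous_phiIntegrand hb hord (d := d) (t := t)
  set R : ℝ := 16 + 4 * t ^ 2 with hR
  have hR0 : 0 < R := by positivity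
  -- the tail: `‖bₙ‖ R ≤ ½` eventually
  obtain ⟨N, hN⟩ : ∃ N : ℕ, ∀ n, N ≤ n → ‖b n‖ * R ≤ 1 / 2 := by
    have h0 := hb.summable.tendsto_atTop_zero
    have hev := (h0.eventually (gt_mem_nhds (show (0:ℝ) < 1 / (2 * R) by positivity)))
    obtain ⟨N, hN⟩ := eventually_atTop.1 hev
    refine ⟨N, fun n hn ↦ ?_⟩
    have := hN n hn
    rw [lt_div_iff₀ (by positivity)] at this
    linarith
  -- the head: compactness bounds
  choose Cf hCf using fun n ↦ (isCompact_Icc : IsCompact (Icc (1 / 2 : ℝ) (1 / 2 + d))).exists_bound_of_continuousOn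
    (f := phiIntegrand d t (b n)) (hcont n).continuousOn
  set M : ℝ := ∑ k ∈ Finset.range N, |Cf k| with hM
  set C : ℕ → ℝ := fun n ↦ 3 * R * ‖b n‖ + if n < N then M else 0 with hC
  have hCsum : Summable C := by
    refine (hb.summable.mul_left (3 * R)).add (summable_of_ne_finset_zero (s := Finset.range N) ?_)
    intro n hn
    rw [Finset.mem_range] at hn
    simp [hn]
  have hbound : ∀ n, ∀ σ ∈ Icc (1 / 2 : ℝ) (1 / 2 + d), ‖phiIntegrand d t (b n) σ‖ ≤ C n := by
    intro n σ hσ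
    by_cases hn : n < N
    · have h1 : ‖phiIntegrand d t (b n) σ‖ ≤ |Cf n| := (hCf n σ hσ).trans (le_abs_self _)
      have h2 : |Cf n| ≤ M :=
        Finset.single_le_sum (f := fun k ↦ |Cf k|) (fun k _ ↦ abs_nonneg _) (Finset.mem_range.2 hn)
      have h3 : 0 ≤ 3 * R * ‖b n‖ := by positivity
      simp only [hC, if_pos hn]
      linarith
    · have hle := abs_phiIntegrand_le hd hd1 ⟨hσ.1, by linarith [hσ.2]⟩ (hN n (not_lt.1 hn))
      simp only [hC, if_neg hn, add_zero, Real.norm_eq_abs]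
      linarith
  refine intervalIntegral.hasSum_integral_of_dominated_convergence (fun n _ ↦ C n)
    (fun n ↦ (hcont n).aestronglyMeasurable) ?_ ?_ ?_ ?_
  · intro n
    refine Filter.Eventually.of_forall fun σ hσ ↦ hbound n σ ?_
    rw [uIoc_of_le (by linarith)] at hσ
    exact ⟨hσ.1.le, hσ.2⟩
  · exact Filter.Eventually.of_forall fun σ _ ↦ hCsum
  · exact intervalIntegrable_const
  · refine Filter.Eventually.of_forall fun σ _ ↦ ?_
    exact hb.hasSum_log_norm_factors_sub (hξ σ) (hξ (σ + d))


/-- **Trudgian's `I₁` bound** (proof of Lemma 2.11, with Booker's `log 4`): for `½ < d ≤ 1` and `t`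
not an ordinate of a zero of `ζ`,
`∫_{1/2}^{1/2+d} (log|ξ(σ+it)| − log|ξ(σ+d+it)|) dσ ≥ −d² log 4 · Re ξ'/ξ(½ + d + it)`,
conditionally on Booker's Lemma 2.10 (the Hadamard product of `ξ`, termwise integration, Booker's
inequality on the pairs `{ρ, 1−ρ̄}` via the conjugation symmetry of the zero multiset, and
`Re ξ'/ξ(s_d) = Σ_ρ Re 1/(s_d − ρ)`). [cite: Trudgian2011, §2.2, proof of Lemma 2.11] -/
theorem integral_log_norm_riemannXi_sub_shift_ge (hB : Trudgian2011_lemma_2_10) {d t : ℝ}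
    (hd : 1 / 2 < d) (hd1 : d ≤ 1) (hord : ∀ ρ : ℂ, riemannZeta ρ = 0 → ρ.im ≠ t) :
    -(d ^ 2 * Real.log 4 * (logDeriv riemannXi (((1 / 2 + d : ℝ) : ℂ) + t * I)).re) ≤
      ∫ σ in (1 / 2 : ℝ)..(1 / 2 + d),
        (Real.log ‖riemannXi (σ + t * I)‖ - Real.log ‖riemannXi ((σ + d : ℝ) + t * I)‖) := by
  obtain ⟨b, hb⟩ := exists_isHadamardSeq 0
  set sd : ℂ := ((1 / 2 + d : ℝ) : ℂ) + t * I with hsd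
  have hsd0 : riemannXi sd ≠ 0 := riemannXi_ne_zero_of_one_le_re (by simp [hsd]; linarith)
  set I₁ : ℝ := ∫ σ in (1 / 2 : ℝ)..(1 / 2 + d),
    (Real.log ‖riemannXi (σ + t * I)‖ - Real.log ‖riemannXi ((σ + d : ℝ) + t * I)‖) with hI₁
  set R : ℝ := (logDeriv riemannXi sd).re with hRdef
  -- `Σ H(bₙ) = Re ξ'/ξ(s_d)`
  have hH : HasSum (fun n ↦ hF d t (b n)) R := by
    have h1 := (hb.summable_logDeriv_riemannXi_terms sd).hasSum
    rw [← hb.logDeriv_riemannXi_eq_tsum hsd0] at h1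
    exact Complex.hasSum_re h1
  -- `Σ Φ(bₙ) = I₁`
  have hΦ : HasSum (fun n ↦ phiF d t (b n)) I₁ := hasSum_phiF hb (by linarith) hd1 hord
  -- the conjugate families
  obtain ⟨e, he⟩ := hb.exists_perm_eq_conj
  have hΦc : HasSum (fun n ↦ phiF d t (conj (b n))) I₁ := by
    have ee : (fun n ↦ phiF d t (conj (b n))) = (fun n ↦ phiF d t (b n)) ∘ e :=
      funext fun n ↦ by simp only [Function.comp_apply, he n]
    rw [ee]; exact (Equiv.hasSum_iff e).2 hΦ
  have hHc : HasSum (fun n ↦ hF d t (conj (b n))) R := by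
    have ee : (fun n ↦ hF d t (conj (b n))) = (fun n ↦ hF d t (b n)) ∘ e :=
      funext fun n ↦ by simp only [Function.comp_apply, he n]
    rw [ee]; exact (Equiv.hasSum_iff e).2 hH
  have hterm := fun n ↦ neg_phiF_add_phiF_conj_le hB hb hd hd1 hord n (t := t)
  have hL : HasSum (fun n ↦ -(phiF d t (b n) + phiF d t (conj (b n)))) (-(I₁ + I₁)) :=
    (hΦ.add hΦc).neg
  have hRs : HasSum (fun n ↦ d ^ 2 * Real.log 4 * (hF d t (b n) + hF d t (conj (b n))))
      (d ^ 2 * Real.log 4 * (R + R)) := (hH.add hHc).mul_left _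
  have key := hasSum_le hterm hL hRs
  linarith

end HadamardBooker


/-! ### `Re ξ'/ξ(½ + d + it) ≤ −ζ'/ζ(½ + d) + ½ log(t/2π) + ε'(t)` -/

section LogDerivBound

open LSeries
open scoped LSeries.notation ArithmeticFunction.vonMangoldt

/-- **`|Σ Λ(n) n^{-s}| ≤ −ζ'(σ)/ζ(σ)`** for `σ = Re s > 1` (termwise, `|Λ(n) n^{-s}| = Λ(n) n^{-σ}`).
Trudgian: "`Re ζ'/ζ(½+d+it) ≤ |ζ'/ζ(½+d+it)| ≤ −ζ'(½+d)/ζ(½+d)`".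
[cite: Trudgian2011, §2.2, proof of Lemma 2.11] -/
theorem norm_LSeries_vonMangoldt_le_of_one_lt_re {s : ℂ} (hs : 1 < s.re) :
    ‖L ↗Λ s‖ ≤ (-deriv riemannZeta (s.re : ℂ) / riemannZeta (s.re : ℂ)).re := by
  set σ : ℝ := s.re with hσ
  have hσ1 : 1 < ((σ : ℂ)).re := by simp [hs]
  have hsum : Summable fun n ↦ ‖term ↗Λ s n‖ :=
    (ArithmeticFunction.LSeriesSummable_vonMangoldt hs).norm
  have hsumσ : LSeriesSummable ↗Λ (σ : ℂ) := ArithmeticFunction.LSeriesSummable_vonMangoldt hσ1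
  have heq : ∀ n, ‖term ↗Λ s n‖ = ‖term ↗Λ (σ : ℂ) n‖ := by
    intro n; rw [norm_term_eq, norm_term_eq]; simp [hσ]
  have hre : ∀ n, ‖term ↗Λ (σ : ℂ) n‖ = (term ↗Λ (σ : ℂ) n).re := by
    intro n
    rcases eq_or_ne n 0 with rfl | hn
    · simp
    rw [term_of_ne_zero hn]
    have e : (↗Λ n : ℂ) / (n : ℂ) ^ (σ : ℂ) = ((ArithmeticFunction.vonMangoldt n / (n : ℝ) ^ σ : ℝ) : ℂ) := by
      push_cast
      rw [Complex.ofReal_cpow (Nat.cast_nonneg n)]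
      push_cast
      rfl
    rw [e, Complex.norm_real, Complex.ofReal_re, Real.norm_eq_abs,
      abs_of_nonneg (div_nonneg ArithmeticFunction.vonMangoldt_nonneg (by positivity))]
  rw [← ArithmeticFunction.LSeries_vonMangoldt_eq_deriv_riemannZeta_div hσ1]
  calc ‖L ↗Λ s‖ = ‖∑' n, term ↗Λ s n‖ := rfl
    _ ≤ ∑' n, ‖term ↗Λ s n‖ := norm_tsum_le_tsum_norm hsum
    _ = ∑' n, (term ↗Λ (σ : ℂ) n).re := tsum_congr fun n ↦ by rw [heq, hre]
    _ = (L ↗Λ (σ : ℂ)).re := (Complex.re_tsum hsumσ).symm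

/-- The small error of the upper bound for `Re ξ'/ξ(s_d)`: `ε'(t) = 4/t² + π/(4t)`. [folklore] -/
def turingEps' (t : ℝ) : ℝ := 4 / t ^ 2 + π / (4 * t)

/-- **`Re ξ'/ξ(½ + d + it) ≤ −ζ'(½+d)/ζ(½+d) + ½ log t − ½ log 2π + ε'(t)`** for `½ < d ≤ 1`,
`t ≥ 1` (`ξ'/ξ = 1/s + 1/(s−1) − ½ log π + ½ ψ(s/2) − Σ Λ(n)n^{-s}` on `Re s > 1`, the explicit
vertical Stirling bound for `Re ψ`, and `norm_LSeries_vonMangoldt_le_of_one_lt_re`).  This is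
the last display before Lemma 2.11 in Trudgian, with his `ε' ≤ 10⁻⁴` replaced by the explicit
`ε'(t)`. [cite: Trudgian2011, §2.2, proof of Lemma 2.11] -/
theorem re_logDeriv_riemannXi_shift_le {d t : ℝ} (hd : 1 / 2 < d) (hd1 : d ≤ 1) (ht : 1 ≤ t) :
    (logDeriv riemannXi (((1 / 2 + d : ℝ) : ℂ) + t * I)).re ≤
      (-deriv riemannZeta ((1 / 2 + d : ℝ) : ℂ) / riemannZeta ((1 / 2 + d : ℝ) : ℂ)).re +
        Real.log t / 2 - Real.log 2 / 2 - Real.log π / 2 + turingEps' t := by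
  set s : ℂ := ((1 / 2 + d : ℝ) : ℂ) + t * I with hsdef
  have ht0 : 0 < t := by linarith
  have hsre : s.re = 1 / 2 + d := by simp [hsdef]
  have hsim : s.im = t := by simp [hsdef]
  have hs1 : 1 < s.re := by rw [hsre]; linarith
  rw [logDeriv_riemannXi_eq_of_one_lt_re hs1]
  -- the pieces
  have h1 : (1 / s).re ≤ 3 / (2 * t ^ 2) := by
    rw [one_div, Complex.inv_re, Complex.normSq_apply, hsre, hsim,
      div_le_div_iff₀ (by nlinarith) (by positivity)]
    nlinarith
  have h2 : (1 / (s - 1)).re ≤ 1 / (2 * t ^ 2) := by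
    rw [one_div, Complex.inv_re, Complex.normSq_apply]
    simp only [Complex.sub_re, Complex.one_re, Complex.sub_im, Complex.one_im, sub_zero, hsre, hsim]
    rw [div_le_div_iff₀ (by nlinarith) (by positivity)]
    nlinarith
  have hlogπ : (-(Real.log π : ℂ) / 2).re = -(Real.log π / 2) := by
    rw [← Complex.ofReal_neg, show (2 : ℂ) = ((2 : ℝ) : ℂ) by norm_num, ← Complex.ofReal_div,
      Complex.ofReal_re]; ring
  -- digamma
  have hs2re : 0 < (s / 2).re := by simp [hsdef]; linarith
  have hs2im : (s / 2).im = t / 2 := by simp [hsdef]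
  have hs2im' : (s / 2).im ≠ 0 := by rw [hs2im]; linarith
  have hψ := Literature.Analysis.SpecialFunctions.Complex.re_digamma_le_log_norm_add hs2re hs2im'
  have hnorm : t / 2 ≤ ‖s / 2‖ := by
    have := abs_im_le_norm (s / 2)
    rwa [hs2im, abs_of_pos (by linarith)] at this
  have hn0 : 0 < ‖s / 2‖ := lt_of_lt_of_le (by linarith) hnorm
  have hlog2 : Real.log ‖s / 2‖ ≤ Real.log t - Real.log 2 + (1 / 2 + d) ^ 2 / (2 * t ^ 2) := by
    have e : ‖s / 2‖ = ‖s‖ / 2 := by rw [norm_div]; norm_num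
    rw [e, Real.log_div (by
      have : 0 < ‖s‖ := by rw [e] at hn0; linarith
      exact this.ne') two_ne_zero]
    have := log_norm_add_mul_I_le (1 / 2 + d) ht0
    rw [← hsdef] at this
    linarith
  have hsq : 1 / (2 * ‖s / 2‖ ^ 2) ≤ 2 / t ^ 2 := by
    rw [div_le_div_iff₀ (by positivity) (by positivity)]
    nlinarith [hnorm, hn0]
  have habs : π / (4 * |(s / 2).im|) = π / (2 * t) := by
    rw [hs2im, abs_of_pos (by linarith)]; ring
  rw [habs] at hψ
  have hψ' : (1 / 2 * Complex.digamma (s / 2)).re = (Complex.digamma (s / 2)).re / 2 := by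
    rw [show (1 / 2 : ℂ) = ((1 / 2 : ℝ) : ℂ) by norm_num, Complex.re_ofReal_mul]; ring
  -- von Mangoldt
  have hΛ : -(L ↗Λ s).re ≤ (-deriv riemannZeta ((1 / 2 + d : ℝ) : ℂ) /
      riemannZeta ((1 / 2 + d : ℝ) : ℂ)).re := by
    have h := norm_LSeries_vonMangoldt_le_of_one_lt_re hs1
    rw [hsre] at h
    have h' := Complex.re_le_norm (-(L ↗Λ s))
    rw [Complex.neg_re, norm_neg] at h'
    exact h'.trans h
  have hd2 : (1 / 2 + d) ^ 2 / (2 * t ^ 2) ≤ 9 / (8 * t ^ 2) := by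
    rw [div_le_div_iff₀ (by positivity) (by positivity)]
    have : (1 / 2 + d) ^ 2 ≤ 9 / 4 := by nlinarith
    nlinarith [sq_nonneg t]
  simp only [Complex.add_re, Complex.sub_re, hlogπ, hψ', turingEps']
  have e1 : (4 : ℝ) / t ^ 2 = 3 / (2 * t ^ 2) + 1 / (2 * t ^ 2) + 9 / (8 * t ^ 2) / 2 + 2 / t ^ 2 / 2 +
      7 / (16 * t ^ 2) := by
    field_simp; ring
  have e2 : π / (4 * t) = π / (2 * t) / 2 := by field_simp; ring
  have hpos : 0 ≤ 7 / (16 * t ^ 2) := by positivity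
  rw [e1, e2]
  linarith

end LogDerivBound


/-! ### The integrals beyond `½ + d` and Trudgian's `I(d)` -/

/-- **Trudgian's `I(d)`** (§2.2, the display defining `I(d)`):
`I(d) = ½∫_{1+2d}^∞ log ζ − ∫_{½+d}^∞ log ζ + ½∫_{1+2d}^{1+4d} log ζ − ∫_{½+d}^{½+2d} log ζ`
(`log ζ(σ)` for real `σ > 1`, written `log ‖ζ(σ)‖`). [cite: Trudgian2011, §2.2, definition of I(d)] -/
def turingI (d : ℝ) : ℝ :=
  1 / 2 * (∫ σ in Ioi (1 + 2 * d), Real.log ‖riemannZeta σ‖) -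
    (∫ σ in Ioi (1 / 2 + d), Real.log ‖riemannZeta σ‖) +
    1 / 2 * (∫ σ in (1 + 2 * d)..(1 + 4 * d), Real.log ‖riemannZeta σ‖) -
    ∫ σ in (1 / 2 + d)..(1 / 2 + 2 * d), Real.log ‖riemannZeta σ‖

/-- For real `σ > 1`: `log ζ(2σ) − log ζ(σ) ≤ log|ζ(σ + it)|` (`|ζ(s)| ≥ ζ(2σ)/ζ(σ)`, Titchmarsh
Thm 8.7). [cite: Trudgian2011, §2.2, before the definition of I(d)] -/
theorem log_norm_riemannZeta_two_mul_sub_le {σ : ℝ} (hσ : 1 < σ) (t : ℝ) :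
    Real.log ‖riemannZeta ((2 * σ : ℝ) : ℂ)‖ - Real.log ‖riemannZeta (σ : ℂ)‖ ≤
      Real.log ‖riemannZeta (σ + t * I)‖ := by
  have hs : 1 < ((σ : ℂ) + t * I).re := by simp [hσ]
  have h := norm_riemannZeta_ge_div hs
  have hre : ((σ : ℂ) + t * I).re = σ := by simp
  rw [hre] at h
  have h1 : 0 < ‖riemannZeta (σ : ℂ)‖ :=
    norm_pos_iff.2 (riemannZeta_ne_zero_of_one_lt_re (by simp [hσ]))
  have h2 : 0 < ‖riemannZeta ((2 * σ : ℝ) : ℂ)‖ :=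
    norm_pos_iff.2 (riemannZeta_ne_zero_of_one_lt_re (by simp; linarith))
  have := Real.log_le_log (div_pos h2 h1) h
  rwa [Real.log_div h2.ne' h1.ne'] at this

/-- `u ↦ log ζ(u)` is interval integrable on `[a, b] ⊂ (1, ∞)`. [folklore] -/
theorem intervalIntegrable_log_norm_riemannZeta_ofReal {a b : ℝ} (ha : 1 < a) (hb : 1 < b) :
    IntervalIntegrable (fun u : ℝ ↦ Real.log ‖riemannZeta u‖) volume a b := by
  have key : ∀ a b : ℝ, 1 < a → a ≤ b →
      IntervalIntegrable (fun u : ℝ ↦ Real.log ‖riemannZeta u‖) volume a b := by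
    intro a b ha hab
    obtain ⟨c, hc1, hca⟩ : ∃ c : ℝ, 1 < c ∧ c < a := ⟨(1 + a) / 2, by linarith, by linarith⟩
    exact (intervalIntegrable_iff_integrableOn_Ioc_of_le hab).2
      ((integrableOn_log_norm_riemannZeta_ofReal hc1).mono_set fun x hx ↦ lt_trans hca hx.1)
  rcases le_total a b with hab | hab
  · exact key a b ha hab
  · exact (key b a hb hab).symm

/-- **Trudgian's `I(d)` bound, unbounded part**: for `½ < d` and `t > 0` not an ordinate,
`∫_{½+d}^∞ log|ζ(σ+it)| dσ ≥ ½∫_{1+2d}^∞ log ζ − ∫_{½+d}^∞ log ζ`.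
[cite: Trudgian2011, §2.2, definition of I(d)] -/
theorem setIntegral_Ioi_log_norm_riemannZeta_ge {d t : ℝ} (hd : 1 / 2 < d) (ht : 0 < t)
    (hord : ∀ ρ : ℂ, riemannZeta ρ = 0 → ρ.im ≠ t) :
    1 / 2 * (∫ σ in Ioi (1 + 2 * d), Real.log ‖riemannZeta σ‖) -
        (∫ σ in Ioi (1 / 2 + d), Real.log ‖riemannZeta σ‖) ≤
      ∫ σ in Ioi (1 / 2 + d), Real.log ‖riemannZeta (σ + t * I)‖ := by
  have hc : 1 < 1 / 2 + d := by linarith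
  have hL : IntegrableOn (fun σ : ℝ ↦ Real.log ‖riemannZeta (σ + t * I)‖) (Ioi (1 / 2 + d)) :=
    (integrableOn_log_norm_riemannZeta ht hord).mono_set (Ioi_subset_Ioi (by linarith))
  have hR1 : IntegrableOn (fun σ : ℝ ↦ Real.log ‖riemannZeta σ‖) (Ioi (1 / 2 + d)) :=
    integrableOn_log_norm_riemannZeta_ofReal hc
  have hR2 : IntegrableOn (fun σ : ℝ ↦ Real.log ‖riemannZeta ((2 * σ : ℝ) : ℂ)‖) (Ioi (1 / 2 + d)) := by
    have h := (integrableOn_Ioi_comp_mul_left_iff (fun u : ℝ ↦ Real.log ‖riemannZeta u‖)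
      (1 / 2 + d) (a := 2) two_pos).2
    have e : (2 : ℝ) * (1 / 2 + d) = 1 + 2 * d := by ring
    rw [e] at h
    exact h (integrableOn_log_norm_riemannZeta_ofReal (by linarith))
  have hval : ∫ σ in Ioi (1 / 2 + d), Real.log ‖riemannZeta ((2 * σ : ℝ) : ℂ)‖ =
      1 / 2 * ∫ σ in Ioi (1 + 2 * d), Real.log ‖riemannZeta σ‖ := by
    have h := MeasureTheory.integral_comp_mul_left_Ioi (fun u : ℝ ↦ Real.log ‖riemannZeta u‖)
      (1 / 2 + d) two_pos
    have e : (2 : ℝ) * (1 / 2 + d) = 1 + 2 * d := by ring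
    rw [e] at h
    simp only [smul_eq_mul] at h
    rw [h]; ring
  have hmono := setIntegral_mono_on
    (f := fun σ : ℝ ↦ Real.log ‖riemannZeta ((2 * σ : ℝ) : ℂ)‖ - Real.log ‖riemannZeta σ‖)
    (hR2.sub hR1) hL measurableSet_Ioi
    (fun σ hσ ↦ log_norm_riemannZeta_two_mul_sub_le (lt_trans hc hσ) t)
  rw [integral_sub hR2 hR1, hval] at hmono
  exact hmono

/-- **Trudgian's `I(d)` bound, bounded part**: for `½ < d` and `t > 0` not an ordinate,
`∫_{½+d}^{½+2d} log|ζ(σ+it)| dσ ≥ ½∫_{1+2d}^{1+4d} log ζ − ∫_{½+d}^{½+2d} log ζ`.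
[cite: Trudgian2011, §2.2, definition of I(d)] -/
theorem intervalIntegral_log_norm_riemannZeta_ge {d t : ℝ} (hd : 1 / 2 < d) (ht : 0 < t)
    (hord : ∀ ρ : ℂ, riemannZeta ρ = 0 → ρ.im ≠ t) :
    1 / 2 * (∫ σ in (1 + 2 * d)..(1 + 4 * d), Real.log ‖riemannZeta σ‖) -
        (∫ σ in (1 / 2 + d)..(1 / 2 + 2 * d), Real.log ‖riemannZeta σ‖) ≤
      ∫ σ in (1 / 2 + d)..(1 / 2 + 2 * d), Real.log ‖riemannZeta (σ + t * I)‖ := by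
  have hc : 1 < 1 / 2 + d := by linarith
  have hle : 1 / 2 + d ≤ 1 / 2 + 2 * d := by linarith
  have hL : IntervalIntegrable (fun σ : ℝ ↦ Real.log ‖riemannZeta (σ + t * I)‖) volume
      (1 / 2 + d) (1 / 2 + 2 * d) :=
    intervalIntegrable_log_norm_riemannZeta ht hord (by linarith) (by linarith)
  have hR1 : IntervalIntegrable (fun σ : ℝ ↦ Real.log ‖riemannZeta σ‖) volume
      (1 / 2 + d) (1 / 2 + 2 * d) := intervalIntegrable_log_norm_riemannZeta_ofReal hc (by linarith)
  have hR2 : IntervalIntegrable (fun σ : ℝ ↦ Real.log ‖riemannZeta ((2 * σ : ℝ) : ℂ)‖) volume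
      (1 / 2 + d) (1 / 2 + 2 * d) := by
    have h := (intervalIntegrable_log_norm_riemannZeta_ofReal (a := 2 * (1 / 2 + d))
      (b := 2 * (1 / 2 + 2 * d)) (by linarith) (by linarith)).comp_mul_left (c := 2)
    have e1 : 2 * (1 / 2 + d) / 2 = 1 / 2 + d := by ring
    have e2 : 2 * (1 / 2 + 2 * d) / 2 = 1 / 2 + 2 * d := by ring
    rw [e1, e2] at h
    exact h
  have hval : ∫ σ in (1 / 2 + d)..(1 / 2 + 2 * d), Real.log ‖riemannZeta ((2 * σ : ℝ) : ℂ)‖ =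
      1 / 2 * ∫ σ in (1 + 2 * d)..(1 + 4 * d), Real.log ‖riemannZeta σ‖ := by
    have h := intervalIntegral.integral_comp_mul_left (fun u : ℝ ↦ Real.log ‖riemannZeta u‖)
      (a := 1 / 2 + d) (b := 1 / 2 + 2 * d) (c := 2) two_ne_zero
    have e1 : (2 : ℝ) * (1 / 2 + d) = 1 + 2 * d := by ring
    have e2 : (2 : ℝ) * (1 / 2 + 2 * d) = 1 + 4 * d := by ring
    rw [e1, e2, smul_eq_mul] at h
    rw [h]; ring
  have hmono := intervalIntegral.integral_mono_on hle (hR2.sub hR1) hL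
    (fun σ hσ ↦ log_norm_riemannZeta_two_mul_sub_le (lt_of_lt_of_le hc hσ.1) t)
  rw [intervalIntegral.integral_sub hR2 hR1, hval] at hmono
  exact hmono

/-! ### Lemma 2.11 assembled -/

/-- **Trudgian's decomposition of `∫ log|ζ|`** (§2.2, "Write Re ∫ log ζ(s) ds = …, where
`½ < d ≤ 1`"): for `d ≥ 0` and `t > 0` not an ordinate,
`∫_{1/2}^∞ log|ζ(σ+it)| dσ = ∫_{1/2}^{1/2+d} (log|ζ(s)| − log|ζ(s+d)|) dσ
  + ∫_{1/2+d}^{1/2+2d} log|ζ(σ+it)| dσ + ∫_{1/2+d}^∞ log|ζ(σ+it)| dσ`.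
[cite: Trudgian2011, §2.2, proof of Lemma 2.11] -/
theorem setIntegral_Ioi_half_log_norm_riemannZeta_eq_decomp {d t : ℝ} (hd : 0 ≤ d) (ht : 0 < t)
    (hord : ∀ ρ : ℂ, riemannZeta ρ = 0 → ρ.im ≠ t) :
    ∫ σ in Ioi (1 / 2 : ℝ), Real.log ‖riemannZeta (σ + t * I)‖ =
      (∫ σ in (1 / 2 : ℝ)..(1 / 2 + d),
          (Real.log ‖riemannZeta (σ + t * I)‖ - Real.log ‖riemannZeta ((σ + d : ℝ) + t * I)‖)) +
        (∫ σ in (1 / 2 + d)..(1 / 2 + 2 * d), Real.log ‖riemannZeta (σ + t * I)‖) +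
        ∫ σ in Ioi (1 / 2 + d), Real.log ‖riemannZeta (σ + t * I)‖ := by
  have hI := integrableOn_log_norm_riemannZeta ht hord
  have hsplit : ∫ σ in Ioi (1 / 2 : ℝ), Real.log ‖riemannZeta (σ + t * I)‖ =
      (∫ σ in (1 / 2 : ℝ)..(1 / 2 + d), Real.log ‖riemannZeta (σ + t * I)‖) +
        ∫ σ in Ioi (1 / 2 + d), Real.log ‖riemannZeta (σ + t * I)‖ := by
    rw [← Ioc_union_Ioi_eq_Ioi (show (1 / 2 : ℝ) ≤ 1 / 2 + d by linarith),
      setIntegral_union (Ioc_disjoint_Ioi le_rfl) measurableSet_Ioi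
        (hI.mono_set Ioc_subset_Ioi_self) (hI.mono_set (Ioi_subset_Ioi (by linarith))),
      intervalIntegral.integral_of_le (by linarith)]
  have I1 : IntervalIntegrable (fun σ : ℝ ↦ Real.log ‖riemannZeta (σ + t * I)‖) volume
      (1 / 2) (1 / 2 + d) := intervalIntegrable_log_norm_riemannZeta ht hord le_rfl (by linarith)
  have I2 : IntervalIntegrable (fun σ : ℝ ↦ Real.log ‖riemannZeta ((σ + d : ℝ) + t * I)‖) volume
      (1 / 2) (1 / 2 + d) := by
    have h := (intervalIntegrable_log_norm_riemannZeta ht hord (a := 1 / 2 + d)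
      (b := 1 / 2 + d + d) (by linarith) (by linarith)).comp_add_right d
    simp only [add_sub_cancel_right] at h
    exact h
  have hshift : ∫ σ in (1 / 2 : ℝ)..(1 / 2 + d), Real.log ‖riemannZeta ((σ + d : ℝ) + t * I)‖ =
      ∫ σ in (1 / 2 + d)..(1 / 2 + 2 * d), Real.log ‖riemannZeta (σ + t * I)‖ := by
    have h := intervalIntegral.integral_comp_add_right
      (fun σ : ℝ ↦ Real.log ‖riemannZeta (σ + t * I)‖) (a := 1 / 2) (b := 1 / 2 + d) d
    have e : (1 / 2 : ℝ) + d + d = 1 / 2 + 2 * d := by ring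
    rw [e] at h
    exact h
  rw [hsplit, intervalIntegral.integral_sub I1 I2, hshift]
  ring

/-- **Trudgian 2011, Lemma 2.11 (exact form, conditional on Booker's Lemma 2.10).**  For
`½ < d ≤ 1` and `t ≥ 1` not the ordinate of a zero of `ζ`,
`−∫_{1/2}^∞ log|ζ(σ+it)| dσ ≤ d² log 4 · (−ζ'(½+d)/ζ(½+d) + ½ log t − ½ log 2π + ε'(t))
   − d² (½ log t − ½ log 2π − ε(t)) − I(d)`,
with `ε(t) = 3/(2t²) + π/(4t)`, `ε'(t) = 4/t² + π/(4t)` (`turingEps`, `turingEps'`) in place of the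
paper's `3ε' = 3·10⁻⁴`; i.e. `−∫ log|ζ| ≤ a₂ + b₂ log t` with `b₂ = (d²/2)(log 4 − 1)` and
`a₂ = d² log 4 (−ζ'/ζ(½+d) − ½ log 2π + ¼) + (d²/2) log π − I(d) + (errors)` as printed.
[cite: Trudgian2011, Lemma 2.11] -/
theorem neg_setIntegral_Ioi_half_log_norm_riemannZeta_le (hB : Trudgian2011_lemma_2_10)
    {d t : ℝ} (hd : 1 / 2 < d) (hd1 : d ≤ 1) (ht : 1 ≤ t)
    (hord : ∀ ρ : ℂ, riemannZeta ρ = 0 → ρ.im ≠ t) :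
    -(∫ σ in Ioi (1 / 2 : ℝ), Real.log ‖riemannZeta (σ + t * I)‖) ≤
      d ^ 2 * Real.log 4 *
          ((-deriv riemannZeta ((1 / 2 + d : ℝ) : ℂ) / riemannZeta ((1 / 2 + d : ℝ) : ℂ)).re +
            Real.log t / 2 - Real.log 2 / 2 - Real.log π / 2 + turingEps' t) -
        d ^ 2 * (Real.log t / 2 - Real.log 2 / 2 - Real.log π / 2 - turingEps t) - turingI d := by
  have ht0 : 0 < t := by linarith
  have hdec := setIntegral_Ioi_half_log_norm_riemannZeta_eq_decomp (by linarith : (0:ℝ) ≤ d) ht0 hord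
  have hA := integral_log_norm_riemannZeta_sub_shift_ge (by linarith : (0:ℝ) ≤ d) ht hord
  have hΞ := integral_log_norm_riemannXi_sub_shift_ge hB hd hd1 hord (t := t)
  have hR := re_logDeriv_riemannXi_shift_le hd hd1 ht
  have hJ₁ := intervalIntegral_log_norm_riemannZeta_ge hd ht0 hord
  have hJ₂ := setIntegral_Ioi_log_norm_riemannZeta_ge hd ht0 hord
  have hlog4 : 0 ≤ d ^ 2 * Real.log 4 := by
    have := Real.log_nonneg (by norm_num : (1:ℝ) ≤ 4); positivity
  have hR' := mul_le_mul_of_nonneg_left hR hlog4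
  simp only [turingI]
  rw [hdec]
  linarith

/-! ### Lemma 2.11 in the form `−∫ log|ζ| ≤ a₂ + b₂ log t` -/

/-- `ε` is decreasing: `ε(t) ≤ ε(t₀)` for `0 < t₀ ≤ t`. [folklore] -/
theorem turingEps_le {t₀ t : ℝ} (h0 : 0 < t₀) (h : t₀ ≤ t) : turingEps t ≤ turingEps t₀ := by
  simp only [turingEps]
  gcongr

/-- `ε'` is decreasing: `ε'(t) ≤ ε'(t₀)` for `0 < t₀ ≤ t`. [folklore] -/
theorem turingEps'_le {t₀ t : ℝ} (h0 : 0 < t₀) (h : t₀ ≤ t) : turingEps' t ≤ turingEps' t₀ := by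
  simp only [turingEps']
  gcongr

/-- Trudgian's `b₂ = (d²/2)(log 4 − 1)` (the `d`-part of `2πb` in Theorem 2.12).
[cite: Trudgian2011, Lemma 2.11] -/
def trudgianB₂ (d : ℝ) : ℝ := d ^ 2 / 2 * (Real.log 4 - 1)

/-- Trudgian's `a₂` (Lemma 2.11) with explicit errors at the threshold `t₀`:
`a₂ = d² log 4 (−ζ'/ζ(½+d) − ½ log 2π + ε'(t₀)) + d² (½ log 2π + ε(t₀)) − I(d)`
(`= d² log 4 {−ζ'/ζ(½+d) − ½ log 2π + ¼} + (d²/2) log π − I(d) + errors`, since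
`d² log 4 · ¼ = (d²/2) log 2`). [cite: Trudgian2011, Lemma 2.11] -/
def trudgianA₂ (d t₀ : ℝ) : ℝ :=
  d ^ 2 * Real.log 4 *
      ((-deriv riemannZeta ((1 / 2 + d : ℝ) : ℂ) / riemannZeta ((1 / 2 + d : ℝ) : ℂ)).re -
        Real.log 2 / 2 - Real.log π / 2 + turingEps' t₀) +
    d ^ 2 * (Real.log 2 / 2 + Real.log π / 2 + turingEps t₀) - turingI d

/-- **Lemma 2.11, `a₂ + b₂ log t` form**: for `½ < d ≤ 1`, `1 ≤ t₀ < t`, `t` not an ordinate,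
`−∫_{1/2}^∞ log|ζ(σ+it)| dσ ≤ a₂(d, t₀) + b₂(d) log t`, conditionally on Booker's Lemma 2.10.
[cite: Trudgian2011, Lemma 2.11] -/
theorem neg_setIntegral_Ioi_half_log_norm_riemannZeta_le' (hB : Trudgian2011_lemma_2_10)
    {d t₀ t : ℝ} (hd : 1 / 2 < d) (hd1 : d ≤ 1) (ht₀ : 1 ≤ t₀) (ht : t₀ < t)
    (hord : ∀ ρ : ℂ, riemannZeta ρ = 0 → ρ.im ≠ t) :
    -(∫ σ in Ioi (1 / 2 : ℝ), Real.log ‖riemannZeta (σ + t * I)‖) ≤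
      trudgianA₂ d t₀ + trudgianB₂ d * Real.log t := by
  have h := neg_setIntegral_Ioi_half_log_norm_riemannZeta_le hB hd hd1 (by linarith) hord
  have h0 : 0 < t₀ := by linarith
  have e1 := turingEps_le h0 ht.le
  have e2 := turingEps'_le h0 ht.le
  have hlog4 : 0 ≤ d ^ 2 * Real.log 4 := by
    have := Real.log_nonneg (by norm_num : (1:ℝ) ≤ 4); positivity
  have hd2 : 0 ≤ d ^ 2 := sq_nonneg d
  simp only [trudgianA₂, trudgianB₂]
  nlinarith [mul_le_mul_of_nonneg_left e2 hlog4, mul_le_mul_of_nonneg_left e1 hd2]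

/-! ### Theorem 2.12 with `K = 2.53`, `θ = ¼` (Lemma 2.5, all `t`) and Booker's `log 4` -/

/-- Trudgian's `b₁ = θ(c − ½)/2` with `θ = ¼`. [cite: Trudgian2011, Lemma 2.8] -/
def trudgianB₁ (c : ℝ) : ℝ := 1 / 4 * ((c - 1 / 2) / 2)

/-- Trudgian's `a₁ = ∫_c^∞ log ζ(σ) dσ + ½(c − ½) log(K ζ(c)) + δ` with `K = 2.53` and the explicit
`δ = (b₁ + c − ½)(Q + c)²/(2t₀²)`, `Q = 5/2` (the shift of `norm_riemannZeta_half_line_le_allT`).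
[cite: Trudgian2011, Lemma 2.8] -/
def trudgianA₁ (c t₀ : ℝ) : ℝ :=
  (∫ σ in Ioi c, Real.log ‖riemannZeta σ‖) + (c - 1 / 2) / 2 * Real.log (2.53 * (riemannZeta c).re)
    + (1 / 4 * ((c - 1 / 2) / 2) + (c - 1 / 2)) * ((5 / 2 + c) ^ 2 / (2 * t₀ ^ 2))

/-- Trudgian's `a = (a₁ + a₂)/π` (Theorem 2.12, the display for `πa`) at threshold `t₀`.
[cite: Trudgian2011, Thm 2.12] -/
def trudgianA (c d t₀ : ℝ) : ℝ := (trudgianA₁ c t₀ + trudgianA₂ d t₀) / π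

/-- Trudgian's `b = (b₁ + b₂)/π`, i.e. `2πb = θ(c − ½) + d²(log 4 − 1)` with `θ = ¼`
(Theorem 2.12, the display for `2πb`). [cite: Trudgian2011, Thm 2.12] -/
def trudgianB (c d : ℝ) : ℝ := (trudgianB₁ c + trudgianB₂ d) / π

/-- `2πb = θ(c − ½) + d²(log 4 − 1)` with `θ = ¼`, as printed in Theorem 2.12.
[cite: Trudgian2011, Thm 2.12] -/
theorem two_pi_mul_trudgianB (c d : ℝ) :
    2 * π * trudgianB c d = 1 / 4 * (c - 1 / 2) + d ^ 2 * (Real.log 4 - 1) := by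
  simp only [trudgianB, trudgianB₁, trudgianB₂]
  field_simp

/-- **Trudgian 2011, Theorem 2.12** (with `K = 2.53`, `θ = ¼` from Lemma 2.5 on all of `σ = ½`,
and Booker's constant `log 4`), conditional on the two named facts `Trudgian2011_lemma_2_5_allT`
(Lehman's Riemann–Siegel bound, all `t > 1`) and `Trudgian2011_lemma_2_10` (Booker's lemma):
for `1 < c`, `½ < d ≤ 1`, `1 ≤ t₀ < t₁ ≤ t₂`,
`|∫_{t₁}^{t₂} S(t) dt| ≤ a(c, d, t₀) + b(c, d) log t₂` with `a = (a₁ + a₂)/π`, `b = (b₁ + b₂)/π`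
(`trudgianA`, `trudgianB`; `two_pi_mul_trudgianB`). Everything else — Turing's lemma, the
Phragmén–Lindelöf convexity bound, the Hadamard-product lower bound — is proved in the tree.
[cite: Trudgian2011, Thm 2.12] -/
theorem abs_integral_zetaArgS_le_trudgian_thm_2_12 (h25 : Trudgian2011_lemma_2_5_allT)
    (hB : Trudgian2011_lemma_2_10) {c d t₀ : ℝ} (hc : 1 < c) (hd : 1 / 2 < d) (hd1 : d ≤ 1)
    (ht₀ : 1 ≤ t₀) {t₁ t₂ : ℝ} (h₁ : t₀ < t₁) (h12 : t₁ ≤ t₂) :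
    |∫ t in t₁..t₂, zetaArgS t| ≤ trudgianA c d t₀ + trudgianB c d * Real.log t₂ := by
  have hline := norm_riemannZeta_half_line_le_allT h25
  have hU : ∀ t : ℝ, t₀ < t → (∀ ρ : ℂ, riemannZeta ρ = 0 → ρ.im ≠ t) →
      ∫ x in Ioi (1 / 2 : ℝ), Real.log ‖riemannZeta (x + t * I)‖ ≤
        trudgianA₁ c t₀ + trudgianB₁ c * Real.log t := fun t ht hord ↦
    setIntegral_Ioi_half_log_norm_riemannZeta_le' (K := 2.53) (θ := 1 / 4) (Q := 5 / 2)
      (by norm_num) (by norm_num) (by norm_num) hc ht₀ hline ht hord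
  have hL : ∀ t : ℝ, t₀ < t → (∀ ρ : ℂ, riemannZeta ρ = 0 → ρ.im ≠ t) →
      -(∫ x in Ioi (1 / 2 : ℝ), Real.log ‖riemannZeta (x + t * I)‖) ≤
        trudgianA₂ d t₀ + trudgianB₂ d * Real.log t := fun t ht hord ↦
    neg_setIntegral_Ioi_half_log_norm_riemannZeta_le' hB hd hd1 ht₀ ht hord
  have hb₁ : 0 ≤ trudgianB₁ c := by simp only [trudgianB₁]; linarith
  have hb₂ : 0 ≤ trudgianB₂ d := by
    simp only [trudgianB₂]
    have : (1 : ℝ) ≤ Real.log 4 := by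
      rw [← Real.log_exp 1]
      exact Real.log_le_log (Real.exp_pos 1) (by have := Real.exp_one_lt_d9; linarith)
    have hd2 : 0 ≤ d ^ 2 := sq_nonneg d
    positivity
  have h := abs_integral_zetaArgS_le_of_bounds ht₀ hb₁ hb₂ hU hL h₁ h12
  simp only [trudgianA, trudgianB]
  convert h using 1

/-- **Reduction of Theorem 2.2 to the two named facts and two real inequalities.**  If, for some
`1 < c`, `½ < d ≤ 1`, the constants of Theorem 2.12 at `t₀ = 168π` satisfy `b(c,d) ≤ 0.059` and
`a(c,d,168π) + (b(c,d) − 0.059) log(168π) ≤ 2.067`, then Lemma 2.5 (all `t`) and Lemma 2.10 imply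
`Literature.NumberTheory.LFunctions.abs_integral_zetaArgS_le_trudgian` (Trudgian's Theorem 2.2:
`|∫_{t₁}^{t₂} S| ≤ 2.067 + 0.059 log t₂` for `t₂ > t₁ > 168π`).  Trudgian takes `c = 11/10`, `d = 3/4`:
`a = 2.0666`, `b = 0.0585` [§2.3]. [cite: Trudgian2011, Thm 2.2 and §2.3] -/
theorem abs_integral_zetaArgS_le_trudgian_of (h25 : Trudgian2011_lemma_2_5_allT)
    (hB : Trudgian2011_lemma_2_10) {c d : ℝ} (hc : 1 < c) (hd : 1 / 2 < d) (hd1 : d ≤ 1)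
    (hb : trudgianB c d ≤ 0.059)
    (ha : trudgianA c d (168 * π) + (trudgianB c d - 0.059) * Real.log (168 * π) ≤ 2.067) :
    abs_integral_zetaArgS_le_trudgian := by
  intro t₁ t₂ ht₁ ht₁₂
  have hπ3 := Real.pi_gt_three
  have ht₀ : (1 : ℝ) ≤ 168 * π := by linarith
  have h := abs_integral_zetaArgS_le_trudgian_thm_2_12 h25 hB hc hd hd1 ht₀ ht₁ ht₁₂.le
  have ht₂ : 168 * π ≤ t₂ := by linarith
  have hlog : Real.log (168 * π) ≤ Real.log t₂ := Real.log_le_log (by linarith) ht₂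
  have key : (trudgianB c d - 0.059) * Real.log t₂ ≤ (trudgianB c d - 0.059) * Real.log (168 * π) :=
    mul_le_mul_of_nonpos_left hlog (by linarith)
  linarith

end Literature.NumberTheory.LFunctions

end
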